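import Mathlib
import Literature.RepresentationTheory.ClassicalInvariants.PowerSumBasicInvariants
import HarnessLib

/-!
# Every power-sum monomial occurs in `e_n`: the support of Newton's expansion (Macdonald I (2.14′))

Topic `Literature/RepresentationTheory/ClassicalInvariants`.  Theorems only (no definition, no named fact, no
instance, no notation).

I. G. Macdonald, *Symmetric Functions and Hall Polynomials* (2nd ed., 1995), Ch. I §2, (2.14′):
`e_n = Σ_{|λ| = n} ε_λ z_λ⁻¹ p_λ` with `ε_λ = (−1)^{|λ| − ℓ(λ)}` and `z_λ = Π_i i^{m_i} m_i! > 0`; in particular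
EVERY power-sum product `p_λ`, `λ ⊢ n`, occurs in the expansion of `e_n`, with the sign `(−1)^{n − ℓ(λ)}`.
Over the tree's `K[y₁, …, yₙ] ≅ K[x]^{𝔖ₙ}`, `y_j ↦ s_{j+1} = p_{j+1}` (`PowerSumBasicInvariants.aeval_psum_bijective`,
Goodman–Wallach Exercise 5.1.3 #4), a partition `λ ⊢ k` with parts `≤ n` is an exponent vector
`m : Fin n →₀ ℕ` of WEIGHT `Σ_j (j+1)·m_j = k` and LENGTH `ℓ(m) = Σ_j m_j`, and the statement becomes:

* `sign_coeff_of_aeval_psum_eq_esymm` (over `ℚ`) — if `Q(s₁, …, sₙ) = e_k` (`k ≤ n`) then for every exponent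
  vector `m` of weight `k`, `(−1)^{k + ℓ(m)} · coeff_m Q > 0`;
* `coeff_ne_zero_of_aeval_psum_eq_esymm` — the same `Q` has ALL weight-`k` coefficients nonzero.

Proof: not Macdonald's generating-function argument but the SIGN INDUCTION on Newton's formulae (2.11′)
`k e_k = Σ_{r=1}^{k} (−1)^{r−1} p_r e_{k−r}` (Mathlib's `MvPolynomial.mul_esymm_eq_sum`): the coefficient of
`y^m` in `k·E_k` is `Σ_{r : m_{r-1} ≥ 1} (−1)^{r−1} coeff_{m − δ_{r−1}} E_{k−r}` and, inductively, every summand has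
the sign `(−1)^{k − ℓ(m)}`; uniqueness of `E_k` is the algebraic independence of the power sums
(`PowerSumBasicInvariants.algebraicIndependent_psum`).

Consumer: route MonotoneRestoration of `Summits/ValiantsHypothesis` (the rank-one shadow of a homomorphism
expansion of the permanent, `Theorems/MonotoneRestorationOrbitRestorationLinearVolumeQPRankOneShadow.lean`:
`per_n = Σ_{i<m} α_i hom_{F_i,n}` forces `m ≥ #{λ ⊢ n}`).  Honest framing: classical algebra; nothing here is
progress on any open problem.
-/

noncomputable section

namespace Literature.RepresentationTheory.ClassicalInvariants.ElementaryPowerSumSupport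

open MvPolynomial Finset PowerSumBasicInvariants

/-- Exponent arithmetic for removing one part `s+1` from a partition: weight drops by `s+1`, length by `1`.
[folklore] -/
private theorem weight_length_sub_single {n : ℕ} (m : Fin n →₀ ℕ) (s : Fin n) (hs : s ∈ m.support) :
    (∑ j : Fin n, m j * ((j : ℕ) + 1)) = (∑ j : Fin n, ((m - Finsupp.single s 1 : Fin n →₀ ℕ) : Fin n → ℕ) j * ((j : ℕ) + 1)) + ((s : ℕ) + 1) ∧
      (∑ j : Fin n, m j) = (∑ j : Fin n, ((m - Finsupp.single s 1 : Fin n →₀ ℕ) : Fin n → ℕ) j) + 1 := by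
  have hle : Finsupp.single s 1 ≤ m := Finsupp.single_le_iff.2 (Nat.one_le_iff_ne_zero.2 (Finsupp.mem_support_iff.1 hs))
  have hm : m = (m - Finsupp.single s 1) + Finsupp.single s 1 := (tsub_add_cancel_of_le hle).symm
  constructor
  · conv_lhs => rw [hm]
    simp only [Finsupp.coe_add, Finsupp.coe_tsub, Pi.add_apply, add_mul, Finset.sum_add_distrib,
      Finsupp.single_apply, ite_mul, one_mul, zero_mul, Finset.sum_ite_eq, Finset.mem_univ, if_true]
  · conv_lhs => rw [hm]
    simp only [Finsupp.coe_add, Finsupp.coe_tsub, Pi.add_apply, Finset.sum_add_distrib, Finsupp.single_apply,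
      Finset.sum_ite_eq, Finset.mem_univ, if_true]

/-- **Macdonald (2.14′), sign form.**  Over `ℚ`: if a polynomial `Q` in the power sums `s₁, …, sₙ` equals `e_k`
(`k ≤ n`), then the coefficient in `Q` of every monomial `y^m` of weight `Σ_j (j+1) m_j = k` is nonzero, of sign
`(−1)^{k − ℓ(m)}`, `ℓ(m) = Σ_j m_j`. [cite: Macdonald1995, Ch. I §2 (2.14′) with (2.11′)] -/
theorem sign_coeff_of_aeval_psum_eq_esymm (n : ℕ) :
    ∀ k, k ≤ n → ∀ Q : MvPolynomial (Fin n) ℚ,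
      aeval (fun j : Fin n => psum (Fin n) ℚ ((j : ℕ) + 1)) Q = esymm (Fin n) ℚ k →
      ∀ m : Fin n →₀ ℕ, (∑ j : Fin n, m j * ((j : ℕ) + 1)) = k →
        0 < (-1 : ℚ) ^ (k + ∑ j : Fin n, m j) * coeff m Q := by
  intro k
  induction k using Nat.strong_induction_on with
  | _ k ih =>
  intro hkn Q hQ m hm
  have hinj : Function.Injective (aeval fun j : Fin n => psum (Fin n) ℚ ((j : ℕ) + 1)) :=
    algebraicIndependent_iff_injective_aeval.1 (algebraicIndependent_psum n)
  rcases Nat.eq_zero_or_pos k with rfl | hk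
  · -- `k = 0`: `Q = 1` and `m = 0`
    have hQ1 : Q = 1 := hinj (by rw [hQ, esymm_zero, map_one])
    have hm0 : m = 0 := by
      ext j
      have := (Finset.sum_eq_zero_iff.1 hm) j (Finset.mem_univ j)
      simpa using this
    subst hQ1 hm0
    simp
  -- `k ≥ 1`: preimages of the lower `e_a`
  have hex : ∀ a, a < k → ∃ Qa : MvPolynomial (Fin n) ℚ,
      aeval (fun j : Fin n => psum (Fin n) ℚ ((j : ℕ) + 1)) Qa = esymm (Fin n) ℚ a := by
    intro a ha
    have h := Literature.RingTheory.MvPolynomial.BlockSymmetric.esymm_mem_adjoin_psum (K := ℚ) (n := n)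
      (k := a) (by omega)
    rw [Algebra.adjoin_range_eq_range_aeval] at h
    exact h
  choose! Qa hQa using hex
  -- the Newton preimage of `e_k`
  let Yv : ℕ → MvPolynomial (Fin n) ℚ := fun r => if h : 0 < r ∧ r ≤ n then X ⟨r - 1, by omega⟩ else 0
  have hYv : ∀ r, 0 < r → r ≤ n →
      aeval (fun j : Fin n => psum (Fin n) ℚ ((j : ℕ) + 1)) (Yv r) = psum (Fin n) ℚ r := by
    intro r h1 h2
    simp only [Yv, dif_pos (And.intro h1 h2), aeval_X]
    congr 1
    omega
  let S : Finset (ℕ × ℕ) := (antidiagonal k).filter fun a => a.1 < k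
  let Q' : MvPolynomial (Fin n) ℚ :=
    (((k : ℚ)⁻¹ * (-1) ^ (k + 1)) : ℚ) • ∑ a ∈ S, ((-1 : MvPolynomial (Fin n) ℚ) ^ a.1 * Qa a.1 * Yv a.2)
  have hS : ∀ a ∈ S, a.1 < k ∧ a.2 = k - a.1 := by
    intro a ha
    simp only [S, mem_filter, Finset.HasAntidiagonal.mem_antidiagonal] at ha
    omega
  have hQ' : aeval (fun j : Fin n => psum (Fin n) ℚ ((j : ℕ) + 1)) Q' = esymm (Fin n) ℚ k := by
    have hsum : ∑ a ∈ S, (-1 : MvPolynomial (Fin n) ℚ) ^ a.1 * esymm (Fin n) ℚ a.1 * psum (Fin n) ℚ a.2 =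
        (-1) ^ (k + 1) * ((k : MvPolynomial (Fin n) ℚ) * esymm (Fin n) ℚ k) := by
      rw [mul_esymm_eq_sum, ← mul_assoc, ← pow_add, Even.neg_one_pow ⟨k + 1, rfl⟩, one_mul]
    have hmap : aeval (fun j : Fin n => psum (Fin n) ℚ ((j : ℕ) + 1))
        (∑ a ∈ S, ((-1 : MvPolynomial (Fin n) ℚ) ^ a.1 * Qa a.1 * Yv a.2)) =
        ∑ a ∈ S, (-1 : MvPolynomial (Fin n) ℚ) ^ a.1 * esymm (Fin n) ℚ a.1 * psum (Fin n) ℚ a.2 := by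
      rw [map_sum]
      refine Finset.sum_congr rfl fun a ha => ?_
      obtain ⟨h1, h2⟩ := hS a ha
      rw [map_mul, map_mul, map_pow, map_neg, map_one, hQa a.1 h1, hYv a.2 (by omega) (by omega)]
    simp only [Q', map_smul]
    rw [hmap, hsum, smul_eq_C_mul, map_mul, map_pow, map_neg, map_one]
    have hk' : (C ((k : ℚ)⁻¹) : MvPolynomial (Fin n) ℚ) * (k : MvPolynomial (Fin n) ℚ) = 1 := by
      rw [← map_natCast (C : ℚ →+* MvPolynomial (Fin n) ℚ) k, ← map_mul,
        inv_mul_cancel₀ (by exact_mod_cast hk.ne'), map_one]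
    have hneg : ((-1 : MvPolynomial (Fin n) ℚ) ^ (k + 1)) * (-1) ^ (k + 1) = 1 := by
      rw [← pow_add, Even.neg_one_pow ⟨k + 1, rfl⟩]
    linear_combination ((-1 : MvPolynomial (Fin n) ℚ) ^ (k + 1) * (-1) ^ (k + 1) * esymm (Fin n) ℚ k) * hk' +
      esymm (Fin n) ℚ k * hneg
  have hQQ : Q = Q' := hinj (by rw [hQ, hQ'])
  -- the coefficient of `y^m`
  have hcoeff : coeff m Q = ((k : ℚ)⁻¹ * (-1) ^ (k + 1)) *
      ∑ a ∈ S, (-1 : ℚ) ^ a.1 * coeff m (Qa a.1 * Yv a.2) := by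
    rw [hQQ]
    simp only [Q', coeff_smul, coeff_sum, smul_eq_mul]
    congr 1
    refine Finset.sum_congr rfl fun a _ => ?_
    rw [show ((-1 : MvPolynomial (Fin n) ℚ) ^ a.1) = C ((-1 : ℚ) ^ a.1) by simp, mul_assoc, coeff_C_mul]
  rw [hcoeff]
  -- each summand, with the sign `(-1)^(k + ℓ(m)) (-1)^(k+1) (-1)^{a.1}`, is `≥ 0`, and one is `> 0`
  have hterm : ∀ a ∈ S,
      0 ≤ (-1 : ℚ) ^ (k + ∑ j : Fin n, m j) * ((-1) ^ (k + 1) * ((-1 : ℚ) ^ a.1 * coeff m (Qa a.1 * Yv a.2))) ∧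
      (∀ s : Fin n, s ∈ m.support → (s : ℕ) + 1 = a.2 →
        0 < (-1 : ℚ) ^ (k + ∑ j : Fin n, m j) * ((-1) ^ (k + 1) * ((-1 : ℚ) ^ a.1 * coeff m (Qa a.1 * Yv a.2)))) := by
    intro a ha
    obtain ⟨h1, h2⟩ := hS a ha
    have hr1 : 0 < a.2 := by omega
    have hr2 : a.2 ≤ n := by omega
    have hY : Yv a.2 = X (⟨a.2 - 1, by omega⟩ : Fin n) := by simp only [Yv, dif_pos (And.intro hr1 hr2)]
    rw [hY, coeff_mul_X']
    by_cases hs : (⟨a.2 - 1, by omega⟩ : Fin n) ∈ m.support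
    · rw [if_pos hs]
      set s : Fin n := ⟨a.2 - 1, by omega⟩ with hsdef
      obtain ⟨hw, hl⟩ := weight_length_sub_single m s hs
      have hs1 : (s : ℕ) + 1 = a.2 := by simp only [hsdef, Fin.val_mk]; omega
      have hw' : (∑ j : Fin n, ((m - Finsupp.single s 1 : Fin n →₀ ℕ) : Fin n → ℕ) j * ((j : ℕ) + 1)) = a.1 := by omega
      have hpos := ih a.1 h1 (by omega) (Qa a.1) (hQa a.1 h1) (m - Finsupp.single s 1) hw'
      have hsign : (-1 : ℚ) ^ (k + ∑ j : Fin n, m j) * ((-1) ^ (k + 1) * ((-1 : ℚ) ^ a.1 *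
          coeff (m - Finsupp.single s 1) (Qa a.1))) =
          (-1 : ℚ) ^ (a.1 + ∑ j : Fin n, ((m - Finsupp.single s 1 : Fin n →₀ ℕ) : Fin n → ℕ) j) * coeff (m - Finsupp.single s 1) (Qa a.1) := by
        have hexp : k + ∑ j : Fin n, m j + (k + 1) + a.1 =
            (a.1 + ∑ j : Fin n, ((m - Finsupp.single s 1 : Fin n →₀ ℕ) : Fin n → ℕ) j) + 2 * (k + 1) := by omega
        rw [← mul_assoc, ← mul_assoc, ← pow_add, ← pow_add, hexp, pow_add, pow_mul, neg_one_sq, one_pow, mul_one]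
      rw [hsign]
      exact ⟨hpos.le, fun _ _ _ => hpos⟩
    · rw [if_neg hs]
      simp only [mul_zero, le_refl, true_and]
      intro s hs' hs1
      exfalso
      apply hs
      have : s = ⟨a.2 - 1, by omega⟩ := Fin.ext (show (s : ℕ) = a.2 - 1 by omega)
      rwa [← this]
  -- a positive summand exists: any part of `m`
  have hm0 : m ≠ 0 := by
    rintro rfl
    simp at hm
    omega
  obtain ⟨s, hs⟩ := Finsupp.support_nonempty_iff.2 hm0
  have hsk : (s : ℕ) + 1 ≤ k := by
    have : m s * ((s : ℕ) + 1) ≤ ∑ j : Fin n, m j * ((j : ℕ) + 1) :=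
      Finset.single_le_sum (f := fun j : Fin n => m j * ((j : ℕ) + 1)) (fun j _ => Nat.zero_le _)
        (Finset.mem_univ s)
    have hms : 1 ≤ m s := Nat.one_le_iff_ne_zero.2 (Finsupp.mem_support_iff.1 hs)
    nlinarith
  have haS : (k - ((s : ℕ) + 1), (s : ℕ) + 1) ∈ S := by
    simp only [S, mem_filter, Finset.HasAntidiagonal.mem_antidiagonal]
    omega
  have hrw : (-1 : ℚ) ^ (k + ∑ j : Fin n, m j) *
      (((k : ℚ)⁻¹ * (-1) ^ (k + 1)) * ∑ a ∈ S, (-1 : ℚ) ^ a.1 * coeff m (Qa a.1 * Yv a.2)) =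
      (k : ℚ)⁻¹ * ∑ a ∈ S, (-1 : ℚ) ^ (k + ∑ j : Fin n, m j) *
        ((-1) ^ (k + 1) * ((-1 : ℚ) ^ a.1 * coeff m (Qa a.1 * Yv a.2))) := by
    simp only [Finset.mul_sum]
    exact Finset.sum_congr rfl fun a _ => by ring
  rw [hrw]
  exact mul_pos (inv_pos.2 (by exact_mod_cast hk))
    (Finset.sum_pos' (fun a ha => (hterm a ha).1) ⟨_, haS, (hterm _ haS).2 s hs rfl⟩)


/-- **Macdonald (2.14′), support form, over `ℚ`**: every weight-`k` monomial has a nonzero coefficient in the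
power-sum expansion of `e_k`. [cite: Macdonald1995, Ch. I §2 (2.14′)] -/
theorem coeff_ne_zero_of_aeval_psum_eq_esymm_rat (n k : ℕ) (hk : k ≤ n) (Q : MvPolynomial (Fin n) ℚ)
    (hQ : aeval (fun j : Fin n => psum (Fin n) ℚ ((j : ℕ) + 1)) Q = esymm (Fin n) ℚ k)
    (m : Fin n →₀ ℕ) (hm : (∑ j : Fin n, m j * ((j : ℕ) + 1)) = k) : coeff m Q ≠ 0 := by
  intro h0
  have := sign_coeff_of_aeval_psum_eq_esymm n k hk Q hQ m hm
  rw [h0, mul_zero] at this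
  exact lt_irrefl _ this

/-- The power sums `p_k = Σ_i x_i^k` are preserved by base change. [cite: Macdonald1995, Ch. I §2 (power sums p_r)] -/
theorem map_psum {σ : Type*} [Fintype σ] {R S : Type*} [CommSemiring R] [CommSemiring S] (f : R →+* S) (k : ℕ) :
    map f (psum σ R k) = psum σ S k := by
  simp [psum, map_sum]

/-- **Macdonald (2.14′), support form, over any field of characteristic `0`**: if `Q(s₁, …, sₙ) = e_k`
(`k ≤ n`) then every monomial of weight `k` has a nonzero coefficient in `Q` — every power-sum product `p_λ`,
`λ ⊢ k`, occurs in `e_k`. [cite: Macdonald1995, Ch. I §2 (2.14′)] -/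
theorem coeff_ne_zero_of_aeval_psum_eq_esymm {K : Type*} [Field K] [CharZero K] (n k : ℕ) (hk : k ≤ n)
    (Q : MvPolynomial (Fin n) K)
    (hQ : aeval (fun j : Fin n => psum (Fin n) K ((j : ℕ) + 1)) Q = esymm (Fin n) K k)
    (m : Fin n →₀ ℕ) (hm : (∑ j : Fin n, m j * ((j : ℕ) + 1)) = k) : coeff m Q ≠ 0 := by
  -- a rational preimage of `e_k`, base-changed to `K`, is THE preimage over `K`
  have hex := Literature.RingTheory.MvPolynomial.BlockSymmetric.esymm_mem_adjoin_psum (K := ℚ) (n := n)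
    (k := k) hk
  rw [Algebra.adjoin_range_eq_range_aeval] at hex
  obtain ⟨Q₀, hQ₀⟩ := hex
  have hinj : Function.Injective (aeval fun j : Fin n => psum (Fin n) K ((j : ℕ) + 1)) :=
    algebraicIndependent_iff_injective_aeval.1 (algebraicIndependent_psum n)
  have hQ₁ : aeval (fun j : Fin n => psum (Fin n) K ((j : ℕ) + 1)) (map (algebraMap ℚ K) Q₀) =
      esymm (Fin n) K k := by
    have h := congrArg (map (algebraMap ℚ K)) hQ₀
    rw [AlgHom.toRingHom_eq_coe, RingHom.coe_coe, aeval_eq_bind₁, map_bind₁, map_esymm] at h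
    have hfun : (fun i : Fin n => map (algebraMap ℚ K) (psum (Fin n) ℚ ((i : ℕ) + 1))) =
        fun j : Fin n => psum (Fin n) K ((j : ℕ) + 1) := funext fun j => map_psum _ _
    rw [hfun] at h
    rw [aeval_eq_bind₁]
    exact h
  have hQQ : Q = map (algebraMap ℚ K) Q₀ := hinj (by rw [hQ, hQ₁])
  rw [hQQ, coeff_map]
  exact (map_ne_zero_iff (algebraMap ℚ K) (algebraMap ℚ K).injective).2
    (coeff_ne_zero_of_aeval_psum_eq_esymm_rat n k hk Q₀ hQ₀ m hm)

end Literature.RepresentationTheory.ClassicalInvariants.ElementaryPowerSumSupport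

end
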